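import Literature.AnabelianGeometry.EtaleTheta.StandardEnvOfSetting
import Literature.AnabelianGeometry.EtaleTheta.Discharge.Sec1StandardType
import Literature.AnabelianGeometry.EtaleTheta.SettingModelKummerDataEmpty
import Literature.AnabelianGeometry.EtaleTheta.SettingModelMuTwo
import HarnessLib

/-!
# [EtTh] Definition 2.7 "orbits of standard type" — the VOCABULARY row F-0573 in the kernel: it IS Def. 1.9 (ii)
# at the étale theta class, independent of the choice of `X̲̲`, orbit-invariant, erratum-stable; vacuous at the root model

S. Mochizuki, *The étale theta function …*, Publ. RIMS **45** (2009) [MochizukiEtTh2009], §2, Def. 2.7, PDF p.41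
(printed 267): "If `η̈^{Θ,ℤ}` is of standard type, then we shall also refer to `η̈^{Θ,l·ℤ}`, `η̲̈^{Θ,l·ℤ}`,
`η̈^{Θ,l·ℤ×μ₂}`, `η̲̈^{Θ,l·ℤ×μ₂}`, `η̈^{Θ,ℤ×μ₂}` as being of standard type"; §1, Def. 1.9 (ii) and Rmk. 1.9.1, PDF
p.29; Def. 2.13 (iv), PDF p.48; the author's *Comments* (March 2022), item (vi) (erratum to Def. 1.9 (ii)).

PROOF-ONLY companion (abc-iut cell, block F fact-proving wave, seat abc-iut-f-132; FACT-LIST row F-0573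
`MuTwoSetting.OrbitsOfStandardType`, [EtTh] Def 2.7 p.41, kernel_closedness = parametrised) of abc-iut-L2-t8's
`StandardEnvOfSetting.lean`.  The row is a DEFINITION (a predicate on the data `(M, E, C, hC, ε_Z, S)`), so there is
nothing to prove "as stated"; what the kernel can certify about the typing is recorded here:
* `orbitsOfStandardType_iff` — Def. 2.7 IS Def. 1.9 (ii) (`MuTwoSetting.IsOfStandardType`, abc-iut-L2-t1) at the
  class `η̈^Θ = E.etaDd` (the print's "If `η̈^{Θ,ℤ}` is of standard type, then we shall also refer to … as being of
  standard type" is a TRANSFER of the name, typed definitionally);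
* `orbitsOfStandardType_iff_of_doubleUnderline` — the choice `C` of `X̲̲` (and the level `l`) "enters only
  through the orbits it names": the predicate does not depend on it;
* `orbitsOfStandardType_iff_exists_eq_one_or_neg_one` — the author's ERRATUM (Comments 2022 (vi): "the unique
  value `∈ O^×_K`" should read "`∈ K^×`") does not change the predicate (L2-t1's
  `isOfStandardType_iff_exists_eq_one_or_neg_one`, transported);
* `orbitsOfStandardType_iff_of_mem_thetaOrbit` — Rmk. 1.9.1: "of standard type" is a property of the ORBIT
  `η̈^{Θ,ℤ}`: every member of the `Π^tp_Ẋ`-orbit of `η̈^Θ` is of standard type iff the orbits of Def. 2.7 are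
  (L2-t1's `isOfStandardType_eq_of_mem`);
* `IsModelBiOfStandardType.orbitsOfStandardType` — Def. 2.13 (iv) ("model bi-theta environment of standard type")
  CONTAINS Def. 2.7 (second conjunct of L2-t8's `IsModelBiOfStandardType`);
* `model_forall_orbitsOfStandardType` / `model_forall_isModelBiOfStandardType` — at the tree's root model
  `MuTwoSetting.model p` (abc-iut-L2-t1; over `ThetaSetting.model p`) EVERY `E`-indexed universal statement is
  VACUOUSLY true: the model carries no Kummer data, hence no étale theta data (abc-iut-w5-d171's
  `ThetaSetting.model_isEmpty_etaleThetaData`; and for `p ≢ 1 (mod 4)` not even `StandardData`, abc-iut-w5-d008's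
  `MuTwoSetting.isEmpty_standardData_model`).
FACT-LIST reading (plan R1/R5): VOCABULARY — consumed BY NAME (`ThetaSystemsStandard.lean`: Cor 2.19 (iii) takes
`hstd : OrbitsOfStandardType C hC εZ S` as a hypothesis).  A kernel `¬ ∀` for the universal closure is NOT
constructible today: every instance needs an étale theta datum `E : EtaleThetaData` and a Def. 1.9 datum
`S : StandardData` (points `τ^{±1}` with evaluation retractions), which have 0 producers at the tree's models
(`StandardDataModelNonVacuity`, `SettingModelKummerDataEmpty`); at the models the closure holds vacuously.

HONEST FRAMING: bookkeeping about OUR typing of a definition; nothing of [EtTh] is asserted (in particular not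
Thm. 1.10 / Cor. 2.19); no side taken on [IUTchIII] Cor. 3.12; typed ≠ proved.
-/

noncomputable section

namespace Literature.AnabelianGeometry.EtaleTheta

open Literature.AnabelianGeometry.SemiGraphs

namespace MuTwoSetting

variable {p : ℕ} [Fact p.Prime] {M : MuTwoSetting p}

/-! ### Def. 2.7 is Def. 1.9 (ii) at `η̈^Θ` -/

/-- **Def. 2.7 IS Def. 1.9 (ii) at the étale theta class**: the orbits `η̈^{Θ,l·ℤ}`, …, `η̈^{Θ,ℤ×μ₂}` derived from
`η̈^Θ = E.etaDd` are of standard type iff `η̈^{Θ,ℤ}` is of standard type in the sense of Def. 1.9 (ii)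
(definitional transfer of the name, as printed: "then we shall also refer to … as being of standard type").
[cite: MochizukiEtTh2009, Def 2.7 p.41] -/
theorem orbitsOfStandardType_iff {E : M.toThetaSetting.EtaleThetaData} {l : ℕ} (C : E.DoubleUnderline l)
    (hC : M.toThetaSetting.Compat) (εZ : M.GtpC) (S : M.StandardData E.toKummerData) :
    OrbitsOfStandardType C hC εZ S ↔ M.IsOfStandardType hC εZ S E.etaDd :=
  Iff.rfl

/-- **The choice of `X̲̲` is immaterial**: for two choices `C`, `C'` (any levels `l`, `l'`) over the same étale
theta datum, the Def. 2.7 predicates coincide ("the choice `C` of `X̲̲` enters only through the orbits it names").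
[cite: MochizukiEtTh2009, Def 2.7 p.41] -/
theorem orbitsOfStandardType_iff_of_doubleUnderline {E : M.toThetaSetting.EtaleThetaData} {l l' : ℕ}
    (C : E.DoubleUnderline l) (C' : E.DoubleUnderline l') (hC : M.toThetaSetting.Compat) (εZ : M.GtpC)
    (S : M.StandardData E.toKummerData) :
    OrbitsOfStandardType C hC εZ S ↔ OrbitsOfStandardType C' hC εZ S :=
  Iff.rfl

/-- **Def. 2.7 under the author's ERRATUM to Def. 1.9 (ii)** (Comments, March 2022, item (vi): "the unique value
`∈ O^×_K`" should read "the unique value `∈ K^×`"): the orbits are of standard type iff some standard set of values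
of `η̈^{Θ,ℤ}` has a value of maximal order equal to `±1` — the unit clause of the 2009 wording is automatic
(abc-iut-L2-t1's `isOfStandardType_iff_exists_eq_one_or_neg_one`). [cite: MochizukiEtTh2009, Def 2.7 p.41] -/
theorem orbitsOfStandardType_iff_exists_eq_one_or_neg_one {E : M.toThetaSetting.EtaleThetaData} {l : ℕ}
    (C : E.DoubleUnderline l) (hC : M.toThetaSetting.Compat) (εZ : M.GtpC)
    (S : M.StandardData E.toKummerData) :
    OrbitsOfStandardType C hC εZ S ↔
      ∃ V, IsStandardSetOfValues hC εZ S E.etaDd V ∧ ∃ v ∈ V,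
        (∀ w ∈ V, ‖((v : M.Kdd) : PadicAlgCl p)‖ ≤ ‖((w : M.Kdd) : PadicAlgCl p)‖) ∧
        (((v : M.Kdd) : PadicAlgCl p) = 1 ∨ ((v : M.Kdd) : PadicAlgCl p) = -1) :=
  isOfStandardType_iff_exists_eq_one_or_neg_one hC εZ S E.etaDd

/-- **"Of standard type" is a property of the ORBIT `η̈^{Θ,ℤ}`** (Rmk. 1.9.1, p.29: inner automorphisms from
`Π^tp_Ẋ` act on `η̈^{Θ,ℤ}`): every member `y` of the `Π^tp_Ẋ`-orbit of `η̈^Θ` is of standard type (Def. 1.9 (ii))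
iff the orbits of Def. 2.7 are (abc-iut-L2-t1's `isOfStandardType_eq_of_mem`). [cite: MochizukiEtTh2009, Def 2.7 p.41] -/
theorem orbitsOfStandardType_iff_of_mem_thetaOrbit {E : M.toThetaSetting.EtaleThetaData} {l : ℕ}
    (C : E.DoubleUnderline l) (hC : M.toThetaSetting.Compat) (εZ : M.GtpC) (S : M.StandardData E.toKummerData)
    {y : M.toThetaSetting.H1 M.toThetaSetting.GtpYdd} (hy : y ∈ M.thetaOrbit hC εZ E.etaDd) :
    M.IsOfStandardType hC εZ S y ↔ OrbitsOfStandardType C hC εZ S :=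
  isOfStandardType_eq_of_mem hC εZ S hy

/-- In particular the class `η̈^Θ` itself is a member of its orbit, at which Def. 2.7 is Def. 1.9 (ii)
(`mem_thetaOrbit_self`). [cite: MochizukiEtTh2009, Def 2.7 p.41] -/
theorem etaDd_mem_thetaOrbit {E : M.toThetaSetting.EtaleThetaData} (hC : M.toThetaSetting.Compat)
    (εZ : M.GtpC) : E.etaDd ∈ M.thetaOrbit hC εZ E.etaDd :=
  mem_thetaOrbit_self hC εZ E.etaDd

/-! ### Def. 2.13 (iv) contains Def. 2.7 -/

/-- **Def. 2.13 (iv) ⟹ Def. 2.7**: a model bi-theta environment "of standard type" has, by definition, orbits of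
standard type (second conjunct of abc-iut-L2-t8's `IsModelBiOfStandardType`). [cite: MochizukiEtTh2009, Def 2.13 (iv) p.48] -/
theorem IsModelBiOfStandardType.orbitsOfStandardType {E : M.toThetaSetting.EtaleThetaData} {l : ℕ} {N : ℕ+}
    {C : E.DoubleUnderline l} {μ : M.toThetaSetting.CyclotomeMod l N} {hC : M.toThetaSetting.Compat}
    {hS : M.toThetaSetting.Sec2Hyps} {εZ : M.GtpC} {S : M.StandardData E.toKummerData} {B : BiThetaEnv.{0}}
    (h : IsModelBiOfStandardType C μ hC hS εZ S B) : OrbitsOfStandardType C hC εZ S :=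
  h.2

/-- Conversely, Def. 2.13 (iv) is EXACTLY "`B` is a model bi-theta environment of the collection" ∧ Def. 2.7.
[cite: MochizukiEtTh2009, Def 2.13 (iv) p.48] -/
theorem isModelBiOfStandardType_iff {E : M.toThetaSetting.EtaleThetaData} {l : ℕ} {N : ℕ+}
    (C : E.DoubleUnderline l) (μ : M.toThetaSetting.CyclotomeMod l N) (hC : M.toThetaSetting.Compat)
    (hS : M.toThetaSetting.Sec2Hyps) (εZ : M.GtpC) (S : M.StandardData E.toKummerData) (B : BiThetaEnv.{0}) :
    IsModelBiOfStandardType C μ hC hS εZ S B ↔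
      (∃ (η : (C.thetaEnvData μ hC hS).PiYdd → MuN p N) (hη : η ∈ (C.thetaEnvData μ hC hS).thetaCocycles),
          B = (C.thetaEnvData μ hC hS).modelBi hη) ∧
        M.IsOfStandardType hC εZ S E.etaDd :=
  Iff.rfl

end MuTwoSetting

/-! ### At the tree's root model: every `E`-indexed closure is vacuous -/

namespace SettingModel

variable (p : ℕ) [Fact p.Prime]

/-- **At the root model `MuTwoSetting.model p` the universal closure of Def. 2.7 holds VACUOUSLY**: the model
carries no étale theta data (`ThetaSetting.model_isEmpty_etaleThetaData`, abc-iut-w5-d171 — no Kummer data over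
`K̈ = ℚ_p`), so there is no `E` to instantiate (and for `p ≢ 1 (mod 4)` no Def. 1.9 datum `S` either,
`MuTwoSetting.isEmpty_standardData_model`). A vacuity certificate, not an instance of the notion.
[cite: MochizukiEtTh2009, Def 2.7 p.41] -/
theorem model_forall_orbitsOfStandardType :
    ∀ (E : (MuTwoSetting.model p).toThetaSetting.EtaleThetaData) (l : ℕ) (C : E.DoubleUnderline l)
      (hC : (MuTwoSetting.model p).toThetaSetting.Compat) (εZ : (MuTwoSetting.model p).GtpC)
      (S : (MuTwoSetting.model p).StandardData E.toKummerData), MuTwoSetting.OrbitsOfStandardType C hC εZ S :=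
  fun E => ((ThetaSetting.model_isEmpty_etaleThetaData p).false E).elim

/-- … and likewise its NEGATION-closure: at the root model NO orbit is of standard type either — both universal
statements hold for want of data (the honest content of "vacuous"). [cite: MochizukiEtTh2009, Def 2.7 p.41] -/
theorem model_forall_not_orbitsOfStandardType :
    ∀ (E : (MuTwoSetting.model p).toThetaSetting.EtaleThetaData) (l : ℕ) (C : E.DoubleUnderline l)
      (hC : (MuTwoSetting.model p).toThetaSetting.Compat) (εZ : (MuTwoSetting.model p).GtpC)
      (S : (MuTwoSetting.model p).StandardData E.toKummerData), ¬ MuTwoSetting.OrbitsOfStandardType C hC εZ S :=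
  fun E => ((ThetaSetting.model_isEmpty_etaleThetaData p).false E).elim

/-- **At the root model the universal closure of Def. 2.13 (iv) holds VACUOUSLY** as well (same reason).
[cite: MochizukiEtTh2009, Def 2.13 (iv) p.48] -/
theorem model_forall_isModelBiOfStandardType :
    ∀ (E : (MuTwoSetting.model p).toThetaSetting.EtaleThetaData) (l : ℕ) (N : ℕ+) (C : E.DoubleUnderline l)
      (μ : (MuTwoSetting.model p).toThetaSetting.CyclotomeMod l N)
      (hC : (MuTwoSetting.model p).toThetaSetting.Compat) (hS : (MuTwoSetting.model p).toThetaSetting.Sec2Hyps)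
      (εZ : (MuTwoSetting.model p).GtpC) (S : (MuTwoSetting.model p).StandardData E.toKummerData)
      (B : BiThetaEnv.{0}), MuTwoSetting.IsModelBiOfStandardType C μ hC hS εZ S B :=
  fun E => ((ThetaSetting.model_isEmpty_etaleThetaData p).false E).elim

/-- The Σ-type of Def. 2.7 data `(E, S)` at the root model is EMPTY — the reason all the above are vacuous.
[cite: MochizukiEtTh2009, Def 2.7 p.41] -/
theorem model_isEmpty_def27Data :
    IsEmpty (Σ E : (MuTwoSetting.model p).toThetaSetting.EtaleThetaData,
      (MuTwoSetting.model p).StandardData E.toKummerData) :=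
  ⟨fun x => (ThetaSetting.model_isEmpty_etaleThetaData p).false x.1⟩

end SettingModel

end Literature.AnabelianGeometry.EtaleTheta

end
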